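import Summits.HodgeConjecture.HodgeConjecture.Theses.KugaSatakeSaturation

/-!
# Route KugaSatakeSaturation — `SaturationOfTwists` (glue item stmt-HodgeConjecture-17611)

`TwistGeneration → TwistAbsorption → Saturation`: a `ℚ`-linear `μ : T → End C(T, Q)` compatible with
the Kuga–Satake filtration is a combination of twisted left multiplications
`t ↦ L_{ι(e t)} ∘ b'` (`TwistGeneration`, `e` a Hodge endomorphism of `T`, `b'` filtration-stable), and
each `t ↦ L_{ι(e t)}` is a combination of sandwiched left multiplications `t ↦ b ∘ L_{ι t} ∘ b''`
(`TwistAbsorption`); post-composing with `b'` (a `ℚ`-linear operation on `T → End`, under which the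
sandwiched generators stay sandwiched, `b'' ∘ b'` being stable) gives `Saturation`.  Linear algebra
(`Submodule.map_span_le`) over the route file; no other import, no named-fact hypothesis, no sorry.
-/

-- `Summit.HodgeConjecture.HodgeConjecture.Theorems` is the mandated namespace (single-problem
-- summit: Problem = Summit), which `linter.dupNamespace` flags on every declaration; the lakefile
-- turns the linter off tree-wide (weak option), restated here so stand-alone elaboration is
-- warning-free too.
set_option linter.dupNamespace false

namespace Summit.HodgeConjecture.HodgeConjecture.Theorems

open Literature.AlgebraicGeometry.Motives

/-- **Item stmt-HodgeConjecture-17611 (`SaturationOfTwists`), route `KugaSatakeSaturation`**: the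
twisted generators of `TwistGeneration` lie in the saturated span — write `t ↦ L_{ι(e t)} ∘ b'` as the
image of `t ↦ L_{ι(e t)}` under post-composition with `b'`, expand the latter by `TwistAbsorption`, and
note that post-composition maps sandwiched generators to sandwiched generators.
[cite: vanGeemen2000KugaSatakeHC, §6] -/
theorem kugaSatakeSaturation_saturationOfTwists_proof :
    Summit.HodgeConjecture.HodgeConjecture.Theses.KugaSatakeSaturation.SaturationOfTwists := by
  intro hG hA T _ _ _ H P hF3 hh20 hrig μ hμ
  refine Submodule.span_le.2 ?_ (hG T H P hF3 hh20 hrig μ hμ)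
  rintro ν ⟨e, b', hb', hν⟩
  -- post-composition with `b'`, a `ℚ`-linear operation on `T →ₗ End C`
  let Ψ : (T →ₗ[ℚ] Module.End ℚ (CliffordAlgebra (LinearMap.BilinMap.toQuadraticMap P.form))) →ₗ[ℚ]
      (T →ₗ[ℚ] Module.End ℚ (CliffordAlgebra (LinearMap.BilinMap.toQuadraticMap P.form))) :=
    LinearMap.llcomp ℚ T _ _ (LinearMap.lcomp ℚ _ b')
  have hΨ : ∀ ν' t, Ψ ν' t = ν' t ∘ₗ b' := fun _ _ ↦ rfl
  have hνΨ : ν = Ψ ((LinearMap.mul ℚ (CliffordAlgebra (LinearMap.BilinMap.toQuadraticMap P.form))).comp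
      ((CliffordAlgebra.ι (LinearMap.BilinMap.toQuadraticMap P.form)).comp e.toLinearMap)) := by
    refine LinearMap.ext fun t ↦ ?_
    rw [hν t, hΨ]
    exact LinearMap.ext fun _ ↦ rfl
  rw [hνΨ]
  refine (Submodule.map_span_le Ψ _ _).2 ?_ (Submodule.mem_map_of_mem (hA T H P hF3 hh20 hrig e))
  rintro ν' ⟨b, b'', hb, hb'', hν'⟩
  refine Submodule.subset_span ⟨b, b'' ∘ₗ b', hb, ?_, fun t ↦ ?_⟩
  · -- `b'' ∘ b'` is filtration-stable
    rw [LinearMap.baseChange_comp, Submodule.map_comp]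
    exact (Submodule.map_mono hb').trans hb''
  · rw [hΨ, hν' t, LinearMap.comp_assoc, LinearMap.comp_assoc]

end Summit.HodgeConjecture.HodgeConjecture.Theorems
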